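/-
COR-CM (cell pub-hodgecm2, stage 2 of the Hodge ladder) — count-neutral KERNEL COMBINATORICS «index-two descent of abstract CM types: Hodge vectors are the
vectors with Hodge marginals» (seat prover-pub-hodgecm2-b23-g41-0, binder prover b23, gen 41; claim QUARTIC-TRANSPORT, CLAIM-ADDENDUM #1 «INDEX-TWO DESCENT»,
HOME/INBOX.md l.10136).
Bookkeeping definitions with bodies (`marg₀`, `marg₁`, `trPair`) + theorems, on top of part I (`Census/IndexTwoDescentDictionary.lean`) and the intrinsic
currency (`CorCM/Prior/AllgGroup*.lean`, `Census/BlockParityLaw.lean`, `Census/CoinvariantFibre.lean`, `Census/CoinvariantTypeSum.lean`) used BY NAME; no `decide`, no certificate, no named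
fact, no `sorry`; `Interfaces.lean` (C1), every E term, B01, `Transposition/*`, `PortJoin/*` untouched.
HONEST FRAMING: `HC_CM` is NOT proved, here or anywhere in the tree; nothing here is a period, a count of record or a headline.
T5: n/a-class (hypothesis binders: `c ∈ H`, `c * c = 1`, `c ≠ 1`, `c` central, `x ∉ H`, `H.index = 2` only); checker: self, 2026-08-23.
-/
import Summits.HodgeConjecture.CorCM.Census.IndexTwoDescentDictionary
import Summits.HodgeConjecture.CorCM.Census.CoinvariantTypeSum

/-!
# Index-two descent of abstract CM types, II: marginals, and `hodgeSpan G = {y | both marginals ∈ hodgeSpan H}`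

Part I (`Census/IndexTwoDescentDictionary.lean`) split an abstract CM type of `(G, c)` along an index-two subgroup `H ∋ c` (`c` central, `x ∉ H`):
`Ψ ↦ (res₀ Ψ, res₁ Ψ) = (Ψ ∩ H, x⁻¹(Ψ ∩ xH))`.  Pushing integer combinations of types forward along the two restrictions gives the

  **marginals** `marg₀ = (res₀)_*`, `marg₁ = (res₁)_* : ℤ[CMF G c] → ℤ[CMF H c]` (§1; `Finsupp.lmapDomain`),

whose type sums are the restrictions of the type sum to the two cosets (`typeSum_marg₀`: `typeSum (marg₀ y) h = typeSum y h`;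
`typeSum_marg₁`: `typeSum (marg₁ y) h = typeSum y (x·h)` — Pohlmann's form of `g = x^e h` on `Ψ` is the form of `h` on `res_e Ψ`).  Hence (§2)

  **`mem_hodgeSpan_iff_marg`**: `y ∈ hodgeSpan (G, c) ↔ marg₀ y ∈ hodgeSpan (H, c) ∧ marg₁ y ∈ hodgeSpan (H, c)`

(the two constants agree automatically: `typeSum y g + typeSum y (cg) = Σ y`, seat b09ʼs `Coinvariant.typeSum_add_typeSum_cmul`) — seat b09's
«hodge(G,c) = {m : both marginals ∈ hodge(G′,c)}» (`HOME/pub-hodgecm2-b09/lean-g32/QUARTIC-TWIST.md` PART VI) for EVERY index-two subgroup through `c`.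
§3 reads pairs and faces on the marginals: pairs go to pairs in BOTH coordinates (`marg₀_pair`, `marg₁_pair`); a face with both places in `H` is a face
of `H` on `marg₀` and vanishes on `marg₁` (`marg₀_gface_coe_coe`, `marg₁_gface_coe_coe`), symmetrically for both places in `xH`
(`marg₀_gface_mul_mul`, `marg₁_gface_mul_mul`), and a MIXED face (one place in each coset) has BOTH marginals zero (`marg₀_gface_coe_mul`,
`marg₁_gface_coe_mul`) — the bi-marginal-zero lattice `Z` of b09's road map is where the mixed faces live.  §4: the exponent lattices themselves,
`trPair : ℤ[CMF H c × CMF H c] ≃ₗ ℤ[CMF G c]` (`Finsupp.domLCongr typePairEquiv⁻¹`).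

## References
* [Pohlmann1968] H. Pohlmann, Algebraic cycles on abelian varieties of complex multiplication type, Ann. of Math. 88 (1968), Thm 1.
-/

namespace Summit.HodgeConjecture.CorCM.Census.IndexTwoDescent

open Finset
open Summit.HodgeConjecture.CorCM.Prior.AllgGroup.RfwfAllgGroup
open Summit.HodgeConjecture.CorCM.Census.BlockParity
open Summit.HodgeConjecture.CorCM.Census.Coinvariant

noncomputable section

variable {G : Type*} [Group G] [Fintype G] [DecidableEq G] {c : G}
variable {H : Subgroup G} [DecidablePred (· ∈ H)]

/-! ## §1 Marginals and their type sums -/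

/-- **The `0`-marginal** `(res₀)_* : ℤ[CMF G c] → ℤ[CMF H c]`, `[Ψ] ↦ [Ψ ∩ H]`. [folklore] -/
def marg₀ (hcH : c ∈ H) : (CMF G c →₀ ℤ) →ₗ[ℤ] (CMF H ⟨c, hcH⟩ →₀ ℤ) :=
  Finsupp.lmapDomain ℤ ℤ (res₀ hcH)

/-- **The `1`-marginal** `(res₁)_* : ℤ[CMF G c] → ℤ[CMF H c]`, `[Ψ] ↦ [x⁻¹(Ψ ∩ xH)]`. [folklore] -/
def marg₁ (hcH : c ∈ H) (hcen : ∀ g : G, g * c = c * g) (x : G) : (CMF G c →₀ ℤ) →ₗ[ℤ] (CMF H ⟨c, hcH⟩ →₀ ℤ) :=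
  Finsupp.lmapDomain ℤ ℤ (res₁ hcH hcen x)

/-- `marg₀ (n·[Ψ]) = n·[res₀ Ψ]`. [folklore] -/
@[simp] theorem marg₀_single (hcH : c ∈ H) (Ψ : CMF G c) (n : ℤ) :
    marg₀ hcH (Finsupp.single Ψ n) = Finsupp.single (res₀ hcH Ψ) n := by
  simp [marg₀, Finsupp.lmapDomain_apply, Finsupp.mapDomain_single]

/-- `marg₁ (n·[Ψ]) = n·[res₁ Ψ]`. [folklore] -/
@[simp] theorem marg₁_single (hcH : c ∈ H) (hcen : ∀ g : G, g * c = c * g) (x : G) (Ψ : CMF G c) (n : ℤ) :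
    marg₁ hcH hcen x (Finsupp.single Ψ n) = Finsupp.single (res₁ hcH hcen x Ψ) n := by
  simp [marg₁, Finsupp.lmapDomain_apply, Finsupp.mapDomain_single]

omit [DecidablePred (· ∈ H)] in
/-- The type sum of `n·[Φ]` at `g` is `n·𝟙_Φ(g)`. [folklore] -/
theorem typeSum_single_apply (Φ : CMF G c) (n : ℤ) (g : G) : typeSum G c (Finsupp.single Φ n) g = n * indG Φ.1 g := by
  rw [← Finsupp.smul_single_one, map_smul, typeSum_single, Pi.smul_apply, smul_eq_mul]

/-- The indicator of the `H`-part: `𝟙_{res₀ Ψ}(h) = 𝟙_Ψ(h)`. [folklore] -/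
theorem indG_res₀ (hcH : c ∈ H) (Ψ : CMF G c) (h : H) : indG (res₀ hcH Ψ).1 h = indG Ψ.1 (h : G) := by
  unfold indG
  simp only [mem_res₀]

/-- The indicator of the `xH`-part: `𝟙_{res₁ Ψ}(h) = 𝟙_Ψ(x·h)`. [folklore] -/
theorem indG_res₁ (hcH : c ∈ H) (hcen : ∀ g : G, g * c = c * g) (x : G) (Ψ : CMF G c) (h : H) :
    indG (res₁ hcH hcen x Ψ).1 h = indG Ψ.1 (x * (h : G)) := by
  unfold indG
  simp only [mem_res₁]

/-- **The type sum of the `0`-marginal is the type sum on `H`**: `typeSum (marg₀ y) h = typeSum y h`. [folklore] -/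
theorem typeSum_marg₀ (hcH : c ∈ H) (y : CMF G c →₀ ℤ) (h : H) :
    typeSum H ⟨c, hcH⟩ (marg₀ hcH y) h = typeSum G c y (h : G) := by
  induction y using Finsupp.induction_linear with
  | zero => simp
  | add y z hy hz => rw [map_add, map_add, map_add, Pi.add_apply, Pi.add_apply, hy, hz]
  | single Ψ n => rw [marg₀_single, typeSum_single_apply, typeSum_single_apply, indG_res₀]

/-- **The type sum of the `1`-marginal is the type sum on `xH`**: `typeSum (marg₁ y) h = typeSum y (x·h)`. [folklore] -/
theorem typeSum_marg₁ (hcH : c ∈ H) (hcen : ∀ g : G, g * c = c * g) (x : G) (y : CMF G c →₀ ℤ) (h : H) :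
    typeSum H ⟨c, hcH⟩ (marg₁ hcH hcen x y) h = typeSum G c y (x * (h : G)) := by
  induction y using Finsupp.induction_linear with
  | zero => simp
  | add y z hy hz => rw [map_add, map_add, map_add, Pi.add_apply, Pi.add_apply, hy, hz]
  | single Ψ n => rw [marg₁_single, typeSum_single_apply, typeSum_single_apply, indG_res₁]

/-! ## §2 Hodge vectors are the vectors with Hodge marginals -/

/-- **Hodge vectors have Hodge marginals.** [folklore] -/
theorem marg_mem_hodgeSpan (hcH : c ∈ H) (hc2 : c * c = 1) (hc1 : c ≠ 1) (hcen : ∀ g : G, g * c = c * g) (x : G)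
    {y : CMF G c →₀ ℤ} (hy : y ∈ hodgeSpan c hc2) :
    marg₀ hcH y ∈ hodgeSpan (⟨c, hcH⟩ : H) (csub_mul_csub hcH hc2) ∧
      marg₁ hcH hcen x y ∈ hodgeSpan (⟨c, hcH⟩ : H) (csub_mul_csub hcH hc2) := by
  obtain ⟨k, hk⟩ := exists_forall_typeSum_eq_of_mem_hodgeSpan c hc2 hcen hy
  exact ⟨mem_hodgeSpan_of_forall_typeSum_eq _ _ (csub_ne_one hcH hc1) (csub_comm hcH hcen) (k := k)
      fun h => by rw [typeSum_marg₀, hk],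
    mem_hodgeSpan_of_forall_typeSum_eq _ _ (csub_ne_one hcH hc1) (csub_comm hcH hcen) (k := k)
      fun h => by rw [typeSum_marg₁, hk]⟩

/-- **Vectors with Hodge marginals are Hodge vectors** (`H` of index two, `x ∉ H`): the two constants agree by `Coinvariant.typeSum_add_typeSum_cmul`. [folklore] -/
theorem mem_hodgeSpan_of_marg (hcH : c ∈ H) (hc2 : c * c = 1) (hc1 : c ≠ 1) (hcen : ∀ g : G, g * c = c * g) (hH : H.index = 2) {x : G}
    (hx : x ∉ H) {y : CMF G c →₀ ℤ} (h0 : marg₀ hcH y ∈ hodgeSpan (⟨c, hcH⟩ : H) (csub_mul_csub hcH hc2))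
    (h1 : marg₁ hcH hcen x y ∈ hodgeSpan (⟨c, hcH⟩ : H) (csub_mul_csub hcH hc2)) : y ∈ hodgeSpan c hc2 := by
  obtain ⟨k₀, hk₀⟩ := exists_forall_typeSum_eq_of_mem_hodgeSpan _ _ (csub_comm hcH hcen) h0
  obtain ⟨k₁, hk₁⟩ := exists_forall_typeSum_eq_of_mem_hodgeSpan _ _ (csub_comm hcH hcen) h1
  have hin : ∀ g : G, g ∈ H → typeSum G c y g = k₀ := fun g hg => by
    rw [← hk₀ ⟨g, hg⟩, typeSum_marg₀]
  have hout : ∀ g : G, g ∉ H → typeSum G c y g = k₁ := fun g hg => by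
    obtain ⟨h, rfl⟩ := exists_eq_mul_of_not_mem hH hx hg
    rw [← hk₁ h, typeSum_marg₁]
  have e1 := typeSum_add_typeSum_cmul c y (1 : G)
  have ex := typeSum_add_typeSum_cmul c y x
  rw [hin 1 H.one_mem, mul_one, hin c hcH] at e1
  rw [hout x hx, hout (c * x) (by rw [cmul_mem_iff hcH]; exact hx)] at ex
  have hk : k₀ = k₁ := by omega
  refine mem_hodgeSpan_of_forall_typeSum_eq c hc2 hc1 hcen (k := k₀) fun g => ?_
  by_cases hg : g ∈ H
  · exact hin g hg
  · rw [hout g hg, hk]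

/-- **THE HODGE LATTICE UNDER INDEX-TWO DESCENT**: `y ∈ hodgeSpan (G, c) ↔ marg₀ y ∈ hodgeSpan (H, c) ∧ marg₁ y ∈ hodgeSpan (H, c)`, for every
central involution `c ≠ 1`, every subgroup `H ∋ c` of index two and every `x ∉ H`. [folklore] -/
theorem mem_hodgeSpan_iff_marg (hcH : c ∈ H) (hc2 : c * c = 1) (hc1 : c ≠ 1) (hcen : ∀ g : G, g * c = c * g) (hH : H.index = 2) {x : G}
    (hx : x ∉ H) (y : CMF G c →₀ ℤ) :
    y ∈ hodgeSpan c hc2 ↔ marg₀ hcH y ∈ hodgeSpan (⟨c, hcH⟩ : H) (csub_mul_csub hcH hc2) ∧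
      marg₁ hcH hcen x y ∈ hodgeSpan (⟨c, hcH⟩ : H) (csub_mul_csub hcH hc2) :=
  ⟨marg_mem_hodgeSpan hcH hc2 hc1 hcen x, fun h => mem_hodgeSpan_of_marg hcH hc2 hc1 hcen hH hx h.1 h.2⟩

/-- **The bi-marginal-zero lattice lies in `hodgeSpan`**: `marg₀ y = 0 ∧ marg₁ y = 0 ⟹ y ∈ hodgeSpan`. [folklore] -/
theorem mem_hodgeSpan_of_marg_eq_zero (hcH : c ∈ H) (hc2 : c * c = 1) (hc1 : c ≠ 1) (hcen : ∀ g : G, g * c = c * g) (hH : H.index = 2)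
    {x : G} (hx : x ∉ H) {y : CMF G c →₀ ℤ} (h0 : marg₀ hcH y = 0) (h1 : marg₁ hcH hcen x y = 0) : y ∈ hodgeSpan c hc2 :=
  mem_hodgeSpan_of_marg hcH hc2 hc1 hcen hH hx (by rw [h0]; exact Submodule.zero_mem _) (by rw [h1]; exact Submodule.zero_mem _)

/-! ## §3 Pairs and faces on the marginals -/

/-- **Pairs go to pairs, `0`-coordinate**: `marg₀ ([Ψ] + [Ψ·c]) = [res₀ Ψ] + [res₀ Ψ · c]`. [folklore] -/
theorem marg₀_pair (hcH : c ∈ H) (Ψ : CMF G c) : marg₀ hcH (pair c Ψ) = pair (⟨c, hcH⟩ : H) (res₀ hcH Ψ) := by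
  rw [pair, pair, map_add, marg₀_single, marg₀_single, res₀_rt_self]

/-- **Pairs go to pairs, `1`-coordinate.** [folklore] -/
theorem marg₁_pair (hcH : c ∈ H) (hcen : ∀ g : G, g * c = c * g) (x : G) (Ψ : CMF G c) :
    marg₁ hcH hcen x (pair c Ψ) = pair (⟨c, hcH⟩ : H) (res₁ hcH hcen x Ψ) := by
  rw [pair, pair, map_add, marg₁_single, marg₁_single, res₁_rt_self]

/-- **A face with both places in `H` is that face of `H` on the `0`-marginal.** [folklore] -/
theorem marg₀_gface_coe_coe (hcH : c ∈ H) (hc2 : c * c = 1) (Ψ : CMF G c) (t t' : H) :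
    marg₀ hcH (gface c hc2 Ψ (t : G) (t' : G)) = gface (⟨c, hcH⟩ : H) (csub_mul_csub hcH hc2) (res₀ hcH Ψ) t t' := by
  rw [gface, gface]
  simp only [map_add, map_sub, marg₀_single, res₀_oflipCM_coe]

/-- **… and vanishes on the `1`-marginal.** [folklore] -/
theorem marg₁_gface_coe_coe (hcH : c ∈ H) (hcen : ∀ g : G, g * c = c * g) (hc2 : c * c = 1) {x : G} (hx : x ∉ H) (Ψ : CMF G c) (t t' : H) :
    marg₁ hcH hcen x (gface c hc2 Ψ (t : G) (t' : G)) = 0 := by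
  rw [gface]
  simp only [map_add, map_sub, marg₁_single, res₁_oflipCM_coe hcH hcen hc2 hx]
  abel

/-- **A face with both places in `xH` vanishes on the `0`-marginal …** [folklore] -/
theorem marg₀_gface_mul_mul (hcH : c ∈ H) (hcen : ∀ g : G, g * c = c * g) (hc2 : c * c = 1) {x : G} (hx : x ∉ H) (Ψ : CMF G c)
    (t t' : H) : marg₀ hcH (gface c hc2 Ψ (x * (t : G)) (x * (t' : G))) = 0 := by
  rw [gface]
  simp only [map_add, map_sub, marg₀_single, res₀_oflipCM_mul hcH hcen hc2 hx]
  abel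

/-- **… and is that face of `H` on the `1`-marginal.** [folklore] -/
theorem marg₁_gface_mul_mul (hcH : c ∈ H) (hcen : ∀ g : G, g * c = c * g) (hc2 : c * c = 1) (x : G) (Ψ : CMF G c) (t t' : H) :
    marg₁ hcH hcen x (gface c hc2 Ψ (x * (t : G)) (x * (t' : G))) =
      gface (⟨c, hcH⟩ : H) (csub_mul_csub hcH hc2) (res₁ hcH hcen x Ψ) t t' := by
  rw [gface, gface]
  simp only [map_add, map_sub, marg₁_single, res₁_oflipCM_mul]

/-- **A MIXED face (one place in `H`, one in `xH`) has zero `0`-marginal …** [folklore] -/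
theorem marg₀_gface_coe_mul (hcH : c ∈ H) (hcen : ∀ g : G, g * c = c * g) (hc2 : c * c = 1) {x : G} (hx : x ∉ H) (Ψ : CMF G c)
    (t t' : H) : marg₀ hcH (gface c hc2 Ψ (t : G) (x * (t' : G))) = 0 := by
  rw [gface]
  simp only [map_add, map_sub, marg₀_single, res₀_oflipCM_coe, res₀_oflipCM_mul hcH hcen hc2 hx]
  abel

/-- **… and zero `1`-marginal**: mixed faces lie in the bi-marginal-zero lattice. [folklore] -/
theorem marg₁_gface_coe_mul (hcH : c ∈ H) (hcen : ∀ g : G, g * c = c * g) (hc2 : c * c = 1) {x : G} (hx : x ∉ H) (Ψ : CMF G c)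
    (t t' : H) : marg₁ hcH hcen x (gface c hc2 Ψ (t : G) (x * (t' : G))) = 0 := by
  rw [gface]
  simp only [map_add, map_sub, marg₁_single, res₁_oflipCM_coe hcH hcen hc2 hx, res₁_oflipCM_mul]
  abel

/-! ## §4 The exponent lattices -/

/-- **The exponent lattices under the splitting**: `ℤ[CMF H c × CMF H c] ≃ₗ ℤ[CMF G c]`, `e_{(Ψ₀,Ψ₁)} ↦ [glue Ψ₀ Ψ₁]`. [folklore] -/
def trPair (hcH : c ∈ H) (hcen : ∀ g : G, g * c = c * g) (hH : H.index = 2) {x : G} (hx : x ∉ H) :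
    (CMF H ⟨c, hcH⟩ × CMF H ⟨c, hcH⟩ →₀ ℤ) ≃ₗ[ℤ] (CMF G c →₀ ℤ) :=
  Finsupp.domLCongr (typePairEquiv hcH hcen hH hx).symm

/-- `trPair e_{(Ψ₀,Ψ₁)} = [glue Ψ₀ Ψ₁]`. [folklore] -/
@[simp] theorem trPair_single (hcH : c ∈ H) (hcen : ∀ g : G, g * c = c * g) (hH : H.index = 2) {x : G} (hx : x ∉ H)
    (p : CMF H ⟨c, hcH⟩ × CMF H ⟨c, hcH⟩) (n : ℤ) :
    trPair hcH hcen hH hx (Finsupp.single p n) = Finsupp.single (glue hcH hcen hH hx p.1 p.2) n := by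
  rw [trPair, Finsupp.domLCongr_single, typePairEquiv_symm_apply]

/-- `trPair⁻¹ [Ψ] = e_{(res₀ Ψ, res₁ Ψ)}`. [folklore] -/
@[simp] theorem trPair_symm_single (hcH : c ∈ H) (hcen : ∀ g : G, g * c = c * g) (hH : H.index = 2) {x : G} (hx : x ∉ H)
    (Ψ : CMF G c) (n : ℤ) :
    (trPair hcH hcen hH hx).symm (Finsupp.single Ψ n) = Finsupp.single (res₀ hcH Ψ, res₁ hcH hcen x Ψ) n := by
  rw [LinearEquiv.symm_apply_eq, trPair_single, glue_res]

/-- The marginals on the product side: `marg₀ (trPair e_{(Ψ₀,Ψ₁)}) = [Ψ₀]`. [folklore] -/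
theorem marg₀_trPair_single (hcH : c ∈ H) (hcen : ∀ g : G, g * c = c * g) (hH : H.index = 2) {x : G} (hx : x ∉ H)
    (p : CMF H ⟨c, hcH⟩ × CMF H ⟨c, hcH⟩) (n : ℤ) :
    marg₀ hcH (trPair hcH hcen hH hx (Finsupp.single p n)) = Finsupp.single p.1 n := by
  rw [trPair_single, marg₀_single, res₀_glue]

/-- The marginals on the product side: `marg₁ (trPair e_{(Ψ₀,Ψ₁)}) = [Ψ₁]`. [folklore] -/
theorem marg₁_trPair_single (hcH : c ∈ H) (hcen : ∀ g : G, g * c = c * g) (hH : H.index = 2) {x : G} (hx : x ∉ H)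
    (p : CMF H ⟨c, hcH⟩ × CMF H ⟨c, hcH⟩) (n : ℤ) :
    marg₁ hcH hcen x (trPair hcH hcen hH hx (Finsupp.single p n)) = Finsupp.single p.2 n := by
  rw [trPair_single, marg₁_single, res₁_glue]

end

end Summit.HodgeConjecture.CorCM.Census.IndexTwoDescent
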